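import Summits.AtomisticToContinuum.HydrodynamicLimit.Theses.TwoClocks
import Summits.AtomisticToContinuum.HydrodynamicLimit.Theses.OneFlightGossipEngine
import Summits.AtomisticToContinuum.HydrodynamicLimit.Theorems.TwoClocksTransferEntropyClockTailRateDefs
import Summits.AtomisticToContinuum.HydrodynamicLimit.Theorems.TwoClocksTransferEntropyClockExplicitKineticFamily
import Summits.AtomisticToContinuum.HydrodynamicLimit.Theorems.OneFlightGossipEngineLocalClampedTransferLDAlongFamiliesSAxisNet
import Summits.AtomisticToContinuum.HydrodynamicLimit.Theorems.TwoClocksTransferEntropyClockRateNodes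
import HarnessLib

/-!
# Line `seet-dock` — crux stmt-AtomisticToContinuum-16625 `TwoClocks.TransferEntropyClock` — strategist ALTERNATIVE skeleton v2 (s2, 2026-08-17)

`TransferEntropyClock := KineticWindowLDUniform → ClampedTransferWindowLD → TransferActivityTails → EnergyCurrentTails →
DiluteSelfConsistency → _root_.HydrodynamicLimit`.

NOT item-registered (the live registered skeleton is the lead's `Lines/tail_rate.lean` v14; `ledger skeleton check` would expire its
stubs). Published as `Cruxes/TransferEntropyClock/Lines/seet_dock.lean` + card `Lines/seet-dock.md` for the lead to adopt at a cycle
boundary if the Gaussian-tails chain (14415: `stub_tailPropagation`) stalls.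

THE VARIATION (strategist census v3, finding F4 "rate necessity"): the landed tail-rate one-window ledger
`TransferEntropyClockTailRateWindowClause.stub_tailRateWindowClause` (p144346) consumes the Gaussian-moment node
`UGibbsSRBRigidity.GaussianTails` (item 14415) at exactly ONE point — `lintegral_cubicTail_le_of_expMoment` turns it into the cubic tail
bound `E[(N+1)⁻¹ Σ 1{K₁ − U′ < |v|}|v|³] ≤ e^{-c′(K₁ − U′)}` at the single rate `c′ = 10 t C_g / κ + 2` forced by the Grönwall rate
`K ≍ K₁`. That is SEET strength: the super-exponential cubic tails `OneFlightGossipEngine.SuperExponentialEnergyTails` = item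
stmt-17701 (OFGE crux r7, staffed; `14415 ⇒ 17701` landed, `TransferEntropyClockRateNodes.seet_of_gaussianTails` p142914, converse
false). By F4 (ballistic co-moving droplets of N-independent size are entropy-invisible, window-invariant competitors of the cubic
cut-off, so the tilt law `β ≍ 1/K₁`, hence the rate `K ≍ K₁`, hence a tail RATE, cannot be avoided inside Yau's ledger) SEET is the
METHOD-MINIMAL true-law input of the energy row. This skeleton docks the clock on it:

* S_K  `stub_kcwuSharpPlus : KCWUSharpPlus` — crux 16659's registered stub, verbatim (as tail-rate).
* S_L′ `stub_lctSharp : LCTSharp` — crux 17691's registered stub, verbatim (as tail-rate v14); fed to the heart by the landed s-axis net.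
* S_S  `stub_seet : OneFlightGossipEngine.SuperExponentialEnergyTails` — item 17701 BY NAME (weaker than 14415).
* S_W″ `stub_tailRateWindowClauseSeet : TailRateWindowClauseSeet` — the D-shape one-window ledger of p144346 with its fifth input
  weakened from GaussianTails to SEET (conclusion VERBATIM `TailRateWindowClause`'s = `ClampedTransferDockRate.WindowClauseRate`'s =
  the hypothesis of the landed `ClampedTransferDockLedgerEndD.stub_ledgerEndD`). ★ PROVED by this seat (v2, 14:2xZ): candidate Theorems
  file `Lines/seet_dock_windowclause.lean` (rc 0, 0 sorry, axioms standard, 399 lines; p144346 with (i) `σ_G` from SEET's `σ₀`, (ii) the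
  SEET instance taken AFTER the rate `c′`, level `K₀S`, (iii) tail level `eT := e^{-c′(K₁−U′)} + ε_S`, `ε_S := ε′/(10(C_T+1))` charged to
  the cubic channel's free `ε′/10` slot) + the SEET 3-child glue (`Lines/seet-dock-LANDING.md` File 2, checked). Theorems/ is prover-only:
  the `sorry` below stays until a prover identity lands the file, then `exact TransferEntropyClockSeetDockWindowClause.stub_tailRateWindowClauseSeet`.
Composition `TransferEntropyClock_of` = `gronwallCoreInBand_of_tailRateLedger` / `transferEntropyClock_of_tailRateNodes` (p143292) with
`hG` replaced by `hS`, kernel-checked below, sorries ONLY in the four stubs.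
Disproof.lean (tree, 2026-08-16T22:05Z): §1 no ex-falso shortcut (composition honest); §5 `not_kineticWindowLDBoundedAllBeta` honoured by
S_K (`∃ β₀(bounds)`) and by the explicit `β₁/C` family node inside the ledger; §6 honoured by S_L′ (`∃ V₀ ∀ V ∃ β₀` before `τ₀`); no
`-- Targets` entry names a stub of this line. SEET's own `Cruxes/SuperExponentialEnergyTails/Disproof.lean` (17701 disprover, 06:34Z): no kill.
-/

noncomputable section

namespace Summit.AtomisticToContinuum.HydrodynamicLimit.Cruxes.TransferEntropyClock.SeetDock

open MeasureTheory Filter Set Topology InformationTheory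
open scoped ENNReal
open Literature.MathematicalPhysics.KineticTheory Literature.Analysis.FluidPDE Literature.Analysis.FunctionSpaces
open Summit.AtomisticToContinuum.HydrodynamicLimit.Theses
open Summit.AtomisticToContinuum.HydrodynamicLimit.Theorems
open Summit.AtomisticToContinuum.HydrodynamicLimit.Theorems.HydroLimitInBandOfHeart
  (GronwallCoreInBand LocalClampedTransferWindowLDFamily CollisionEnergyActivityTails KineticCurrentsWindowLDFamily)
open Summit.AtomisticToContinuum.HydrodynamicLimit.Theorems.TransferEntropyClockTailRate (KCWUSharpPlus KineticLDExplicitFamily)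
open Summit.AtomisticToContinuum.HydrodynamicLimit.Theorems.LocalClampedTransferSketch (LCTSharp)

/-! ## §1 The one new statement: the D-ledger docked on SEET -/

/-- **S_W″ target `TailRateWindowClauseSeet`** — `TransferEntropyClockTailRate.TailRateWindowClause` (p143292/p144346) with its fifth
hypothesis `UGibbsSRBRigidity.GaussianTails` (item 14415) WEAKENED to `OneFlightGossipEngine.SuperExponentialEnergyTails` (item 17701);
the conclusion is copied verbatim (the D-shape one-window entropy ledger = hypothesis of `ClampedTransferDockLedgerEndD.stub_ledgerEndD`). -/
def TailRateWindowClauseSeet : Prop :=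
  KineticLDExplicitFamily → LocalClampedTransferWindowLDFamily → CollisionEnergyActivityTails →
    OneFlightGossipEngine.CollisionActivityTails → OneFlightGossipEngine.SuperExponentialEnergyTails →
    OneFlightGossipEngine.EnergyCurrentTails →
  ∀ (r : ℝ) (Rf : ℝ → ℝ), 0 < r →
    (∃ p : FormalMultilinearSeries ℝ ℝ ℝ, HasFPowerSeriesOnBall Rf p 0 (ENNReal.ofReal r)) →
    (∃ L : NNReal, LipschitzOnWith L Rf (Icc 0 r)) →
    (∀ x ∈ Ioo (-r) r, 0 < Rf x ∧ Rf x * (∑' j : ℕ, bE j / (j.factorial : ℝ) * (x * Rf x) ^ j) = 1) →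
    (∀ x ∈ Icc 0 r, 1 ≤ Rf x ∧ Rf x ≤ 2) → ContinuousOn Rf (Icc 0 r) →
    (∀ x ∈ Ioo (-r) r, ∀ R ∈ Icc (1 / 2 : ℝ) 2,
      R * (∑' j : ℕ, bE j / (j.factorial : ℝ) * (x * R) ^ j) = 1 → R = Rf x) →
    ∀ η₀ : ℝ, 0 < η₀ →
    (∀ (a θ₀ : T3 → ℝ) (u₀ : T3 → V3), Continuous a → Continuous θ₀ → Continuous u₀ → (∀ x, 0 < a x) →
      (∀ x, 0 < θ₀ x) → ∀ σ : ℝ, 0 < σ → σ ^ 3 * (⨆ x, a x) ≤ η₀ * ∫ x, a x →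
      ∃ ρ₀ : T3 → ℝ, Continuous ρ₀ ∧ (∀ x, 0 < ρ₀ x) ∧
        (∀ (N : ℕ) (Φ : HardSphereFlow (Torus.geometry (Fin 3)) (hsDiameter σ N) (N + 1)),
          IsProbabilityMeasure (localGibbsLaw σ a u₀ θ₀ N Φ)) ∧
        ∀ χ : T3 → ℝ, Continuous χ → ∀ δ : ℝ, 0 < δ → ∃ C : ℝ, 0 < C ∧
          ∀ (N : ℕ) (Φ : HardSphereFlow (Torus.geometry (Fin 3)) (hsDiameter σ N) (N + 1)),
            localGibbsLaw σ a u₀ θ₀ N Φ {z | δ < |empiricalDensityField z χ - ∫ x, χ x * ρ₀ x|} ≤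
                ENNReal.ofReal (C * Real.exp (-(C⁻¹ * ((N : ℝ) + 1)))) ∧
              localGibbsLaw σ a u₀ θ₀ N Φ
                  {z | δ < ‖empiricalMomentumField z χ - ∫ x, (χ x * ρ₀ x) • u₀ x‖} ≤
                ENNReal.ofReal (C * Real.exp (-(C⁻¹ * ((N : ℝ) + 1)))) ∧
              localGibbsLaw σ a u₀ θ₀ N Φ {z | δ < |empiricalEnergyField z χ -
                  ∫ x, χ x * totalEnergyDensity (ρ₀ x) (u₀ x) (θ₀ x)|} ≤
                ENNReal.ofReal (C * Real.exp (-(C⁻¹ * ((N : ℝ) + 1))))) →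
    ∃ ηp : ℝ, 0 < ηp ∧
    ∀ (a₀ θ₀ : T3 → ℝ) (u₀ : T3 → V3), Continuous a₀ → Continuous θ₀ → Continuous u₀ →
      (∀ x, 0 < a₀ x) → (∀ x, 0 < θ₀ x) →
      ∃ σ₀ : ℝ, 0 < σ₀ ∧ ∀ σ : ℝ, 0 < σ → σ < σ₀ →
        ∀ (T : ℝ) (ρ θ : ℝ → T3 → ℝ) (u : ℝ → T3 → V3), IsHardSphereEulerSolution σ T ρ u θ →
          (∀ s ∈ Set.Ico 0 T, ∀ x, ρ s x * σ ^ 3 < ηp) →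
          ∀ Φ : (N : ℕ) → HardSphereFlow (Torus.geometry (Fin 3)) (hsDiameter σ N) (N + 1),
            TendstoHydroFieldsAt (fun N => localGibbsLaw σ a₀ u₀ θ₀ N (Φ N)) Φ ρ u θ 0 →
            ∀ t ∈ Set.Ioo 0 T,
              ∃ Cst : ℝ → ℝ, ContinuousOn Cst (Set.Icc 0 t) ∧
                (∀ ε : ℝ, 0 < ε → ∃ N₀ : ℕ, ∀ N : ℕ, N₀ ≤ N → ∀ t' ∈ Set.Icc 0 t,
                  |Real.log (posPartition (fun x => ρ t' x * Rf (σ ^ 3 * ρ t' x)) (hsDiameter σ N) (N + 1)) -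
                      Real.log (posPartition (fun x => ρ 0 x * Rf (σ ^ 3 * ρ 0 x)) (hsDiameter σ N) (N + 1)) +
                    ((N : ℝ) + 1) * ∫ r in (0 : ℝ)..t', Cst r| ≤ ((N : ℝ) + 1) * ε) ∧
                ∀ δ : ℝ, 0 < δ → ∃ K : ℝ, 0 ≤ K ∧ ∃ ε : ℝ, 0 < ε ∧ 4 * (1 + t) * ε * Real.exp (2 * K * t) ≤ δ ∧
                ∃ τ : ℝ, 0 < τ ∧ ∃ N₀ : ℕ, ∀ N : ℕ, N₀ ≤ N →
                ∀ s : ℝ, 0 ≤ s → s + τ * ((N : ℝ) + 1) ^ (-(1 / 3 : ℝ)) ≤ t →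
                (klDiv ((Φ N).lawAt (localGibbsLaw σ a₀ u₀ θ₀ N (Φ N)) (s + τ * ((N : ℝ) + 1) ^ (-(1 / 3 : ℝ))))
                  (localGibbsLaw σ (fun x => ρ (s + τ * ((N : ℝ) + 1) ^ (-(1 / 3 : ℝ))) x *
                      Rf (σ ^ 3 * ρ (s + τ * ((N : ℝ) + 1) ^ (-(1 / 3 : ℝ))) x))
                    (u (s + τ * ((N : ℝ) + 1) ^ (-(1 / 3 : ℝ)))) (θ (s + τ * ((N : ℝ) + 1) ^ (-(1 / 3 : ℝ))))
                    N (Φ N))).toReal ≤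
                (klDiv ((Φ N).lawAt (localGibbsLaw σ a₀ u₀ θ₀ N (Φ N)) s)
                  (localGibbsLaw σ (fun x => ρ s x * Rf (σ ^ 3 * ρ s x)) (u s) (θ s) N (Φ N))).toReal +
                K * (τ * ((N : ℝ) + 1) ^ (-(1 / 3 : ℝ))) *
                  sSup ((fun s' => (klDiv ((Φ N).lawAt (localGibbsLaw σ a₀ u₀ θ₀ N (Φ N)) s')
                    (localGibbsLaw σ (fun x => ρ s' x * Rf (σ ^ 3 * ρ s' x)) (u s') (θ s') N (Φ N))).toReal) ''
                    Set.Icc 0 (s + τ * ((N : ℝ) + 1) ^ (-(1 / 3 : ℝ)))) +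
                (τ * ((N : ℝ) + 1) ^ (-(1 / 3 : ℝ))) * ((N : ℝ) + 1) * ε +
                ((Real.log (posPartition (fun x => ρ (s + τ * ((N : ℝ) + 1) ^ (-(1 / 3 : ℝ))) x *
                      Rf (σ ^ 3 * ρ (s + τ * ((N : ℝ) + 1) ^ (-(1 / 3 : ℝ))) x)) (hsDiameter σ N) (N + 1)) -
                    Real.log (posPartition (fun x => ρ s x * Rf (σ ^ 3 * ρ s x)) (hsDiameter σ N) (N + 1))) +
                  (τ * ((N : ℝ) + 1) ^ (-(1 / 3 : ℝ))) * ((N : ℝ) + 1) * Cst s)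

/-! ## §2 Stubs (sorries only here) -/

/-- S_K (open, research-level; verbatim crux 16659's registered stub and tail-rate's `stub_kcwuSharpPlus`). -/
theorem stub_kcwuSharpPlus : KCWUSharpPlus := by
  sorry

/-- S_L′ (open, research-level; verbatim crux 17691's ONE open stub, as tail-rate v14). -/
theorem stub_lctSharp : LCTSharp := by
  sorry

/-- S_S (open, research-level; item stmt-17701 BY NAME — OFGE crux r7, lead c1's line: Povzner ceiling / chaos ceiling / rate floor):
super-exponential cubic velocity tails under the true pre-shock law, `∀ c > 0 ∃ K₀ ∀ K ≥ K₀ ∀ ε ∃ N₀ ∀ N ≥ N₀ ∀ s ≤ t,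
E[(N+1)⁻¹ Σᵢ 1{K < |vᵢ(s)|} |vᵢ(s)|³] ≤ e^{-cK} + ε`. Strictly weaker than 14415 (`seet_of_gaussianTails`, p142914). -/
theorem stub_seet : OneFlightGossipEngine.SuperExponentialEnergyTails := by
  sorry

/-- S_W″ (PROVED — candidate `Lines/seet_dock_windowclause.lean`, rc 0 / 0 sorry; `sorry` here only until a prover lands it). -/
theorem stub_tailRateWindowClauseSeet : TailRateWindowClauseSeet := by
  sorry

/-! ## §3 Kernel-checked composition -/

/-- **The guarded Grönwall core from the SEET-docked D-ledger** (= `TransferEntropyClockTailRate.gronwallCoreInBand_of_tailRateLedger`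
with `hG : GaussianTails` replaced by `hS : SuperExponentialEnergyTails`): window continuity (p118327), a-priori bound, D-ledger end
`stub_ledgerEndD` (p139514), all landed. [cite: Yau1991, §2] -/
theorem gronwallCoreInBand_of_seetLedger (hW : TailRateWindowClauseSeet) (hKE : KineticLDExplicitFamily)
    (hL : LocalClampedTransferWindowLDFamily) (hS : OneFlightGossipEngine.SuperExponentialEnergyTails)
    (h₇ : TwoClocks.TransferActivityTails) (h₆ : TwoClocks.EnergyCurrentTails) : GronwallCoreInBand :=
  have hT := HydroLimitInBandHeart.activityTails_of_transferActivityTails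
    (TransferEntropyClockFamilyNodes.transferActivityTails_iff_dock.mp h₇)
  have h₆' : OneFlightGossipEngine.EnergyCurrentTails := twoClocks_energyCurrentTails_iff.mp h₆
  have hC : ClampedCurrentsDockFromWindows.WindowContinuityInBand :=
    HydroLimitInBandContinuity.stub_windowContinuityInBand hT.1 hT.2 h₆'
  ClampedTransferDockLedgerEndD.stub_ledgerEndD (hW hKE hL hT.2 hT.1 hS h₆') hC EntropyClockDock.ledgerAprioriBound

/-- **tail-rate ⊆ seet-dock**: the Gaussian-tails clause of the live line implies this line's clause is NOT claimed (wrong direction);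
what holds is that the live line's INPUT implies this line's input (`seet_of_gaussianTails`), recorded here by name. [folklore] -/
theorem seet_of_gaussianTails (h : UGibbsSRBRigidity.GaussianTails) : OneFlightGossipEngine.SuperExponentialEnergyTails :=
  TransferEntropyClockRateNodes.seet_of_gaussianTails h

/-- **The crux by name** from the four stubs: explicit kinetic family by cone scaling (p143300) fed S_K, the heart's local transfer
family node from S_L′ through the landed s-axis net (p147087), SEET from S_S, the SEET-docked ledger S_W″; TA and ECT consumed, C′ implied
by S_L′ (p147268), KWLDU and DSC idle — exactly as in tail-rate. [cite: Yau1991, §2] -/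
theorem TransferEntropyClock_of : TwoClocks.TransferEntropyClock :=
  fun _ _ h₇ h₆ _ =>
    TransferEntropyClockFamilyNodes.hydrodynamicLimit_iff_hydroLimitInBand.mpr
      (Theorems.hydroLimitInBand_of_relEntropyVanishingInBand
        (Theorems.EntropyClockDock.relEntropyVanishingInBand_of_gronwallCoreInBand
          (gronwallCoreInBand_of_seetLedger stub_tailRateWindowClauseSeet
            (TransferEntropyClockExplicitKineticFamily.stub_explicitKineticFamily stub_kcwuSharpPlus)
            (show LocalClampedTransferWindowLDFamily from LocalClampedTransferSketch.stub_sAxisNet stub_lctSharp)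
            stub_seet h₇ h₆)))

end Summit.AtomisticToContinuum.HydrodynamicLimit.Cruxes.TransferEntropyClock.SeetDock

end
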